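import Literature.Geometry.Kaehler.ComplexTorusQuaternionMultiplicationSplit
import HarnessLib

/-!
# The Picard number of the quaternionic family is `ρ(A(τ)) = 2 + [L_τ : ℚ]` (`a < 0 < b`, any `Q`): `3` at a general
# point, `4` exactly on the countable CM locus `[L_τ : ℚ] = 2` (Hulek–Laface §1; Lange §5.1.5 Ex. (2); KRY §3.4)

Layer `Literature/Geometry/Kaehler`, namespace `Literature.Geometry.Kaehler.ComplexTorus.QuaternionType`; lane
`lit-hodgefound` (Track 2 foundations library), seat p12 gen 14, row g14-#8 — sequel of g14-#7 `…Split`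
(`exists_isIsogenous_sq_of_not_isSimple` without division hypothesis, `not_isSimple_of_split`,
`finrank_fixed_le_two_of_split`), g14-#6 `…CMIsogenyClass` (`End_ℚ(Y) ≃ L_τ`), g14-#5 `…CMField`
(`exists_fixedSubalgebra`, `fixed_eq_bot_iff_isSimple`, `finrank_fixed_le_two`), g14-#3 `…CMPoints` (`finite_setOf_eigen`),
g13-#4 `…PicardNumber` (`ρ = 3` for simple members) and the tree's
`IsIsogenous.finrank_neronSeveriGroup_eq_two_add_of_isIsogenous` (`ρ(Y × Y') = 2 + [End_ℚ(Y) : ℚ]` for `Y ∼ Y'`).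
THEOREMS ONLY (no definition, no named fact).

## The print

* K. Hulek, R. Laface, *On the Picard numbers of abelian varieties*, Ann. Sc. Norm. Super. Pisa (2019) §1 (held
  `paper:arxiv-1703.05882` p0002): «abelian surfaces with quaternionic multiplication have Picard number three, unless
  they also have complex multiplication, in which case they are isogenous to the self-product of an elliptic curve
  with complex multiplication and thus have Picard number four».
* H. Lange, *Abelian Varieties over the Complex Numbers* (2023) §5.1.5 Exercise (2) (= Lange–Birkenhake 1992 Ch. 10
  Ex. (2), held p0250): the endomorphism algebras of abelian surfaces, case (a)(ii) `End_ℚ(X) ≃ M₂(End_ℚ(E₁))`.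
* S. Kudla, M. Rapoport, T. Yang (2006) §1 p0009, §3.4: the CM points `Z(t)` of the family are «a finite set of
  points» for each `t` — here: the CM locus is countable.

## What is proved (`Q = (a, b)_ℚ`, `Im τ ≠ 0`, `A(τ) = period a b _ hb hτ`, `S = L_τ` via `hS` as in g14-#5)

* §1 (`a ≠ 0 < b`, any `Q`) **`countable_setOf_exists_eigen`** (the `τ` with `ρ(λ)u_τ ∈ ℂu_τ` for some
  `λ ∈ Q ∖ ℚ` form a countable set), **`countable_setOf_fixed_ne_bot`** (the CM locus `{τ : L_τ ≠ ℚ}` is countable).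
* §2 (`a < 0 < b`, any `Q`) **`forall_isUnit_of_isSimple`** (a simple member forces `Q` to be a division algebra),
  **`finrank_fixed_le_two'`** (`[L_τ : ℚ] ≤ 2` with no division hypothesis), and the formula
  **`finrank_neronSeveriGroup_eq_two_add_finrank_fixed`**: `ρ(A(τ)) = 2 + [L_τ : ℚ]` for EVERY member; hence
  **`finrank_neronSeveriGroup_eq_three_or_eq_four`**, **`finrank_neronSeveriGroup_eq_four_iff`** (`ρ = 4` iff
  `[L_τ : ℚ] = 2`, the CM points), **`finrank_neronSeveriGroup_eq_three_iff`** (`ρ = 3` iff `L_τ = ℚ`),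
  **`countable_setOf_finrank_neronSeveriGroup_eq_four`** («Picard number three, unless … complex multiplication …
  four»: `ρ = 4` only on a countable set of `τ`, for the split family as well).

## Scope, in numbers (what is NOT asserted)

`a < 0` is needed for the Riemann form (p28's `exists_admissible`); nothing is said for `a > 0`. The CM locus is only
shown countable (not described as a set of quadratic irrationalities).

## References

* [HulekLaface2019PicardNumbersAV] K. Hulek, R. Laface, *On the Picard numbers of abelian varieties* (2019), §1, §5.1.
* [Lange2023AbelianVarietiesComplex] H. Lange, *Abelian Varieties over the Complex Numbers* (2023), §5.1.5 Exercise (2),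
  §2.6.3 Exercise (2).
* [KudlaRapoportYang2006] S. Kudla, M. Rapoport, T. Yang, *Modular Forms and Special Cycles on Shimura Curves* (2006),
  §1, §3.4.
* [Lang1982AbelianFunctions] S. Lang, *Introduction to Algebraic and Abelian Functions* (1982), Ch. IX §5.
-/

noncomputable section

open Module Matrix Quaternion Complex

namespace Literature.Geometry.Kaehler

namespace ComplexTorus

namespace QuaternionType

/-! ## §1 The CM locus is countable (any `a ≠ 0 < b`) -/

section Countable

variable {a b : ℤ} (ha : a ≠ 0) (hb : 0 < b)

include ha in
/-- **The `τ` admitting an eigen-relation `ρ(λ)u_τ = g u_τ` with `λ ∈ Q ∖ ℚ` form a countable set** (`Q` is countable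
and each `λ ∉ ℚ` has at most two eigen-lines `(τ, 1)`; g14-#3 `finite_setOf_eigen`), with no division hypothesis.
[cite: KudlaRapoportYang2006, §1 p. 9 («`Z(t)` is a finite set of points») and §3.4 (3.4.9)] [cite: HulekLaface2019PicardNumbersAV, §5.1 Prop. 5.1 (proof: «a general member»)] -/
theorem countable_setOf_exists_eigen :
    Set.Countable {τ : ℂ | ∃ lam : ℍ[ℚ,(a : ℚ),(b : ℚ)], lam ∉ (⊥ : Subalgebra ℚ ℍ[ℚ,(a : ℚ),(b : ℚ)]) ∧
      ∃ g : ℂ, act (rho a b hb.le (castQ a b lam)) (uVec τ) = g • uVec τ} := by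
  haveI : Countable ℍ[ℚ,(a : ℚ),(b : ℚ)] :=
    Countable.of_equiv _ (QuaternionAlgebra.equivTuple (a : ℚ) 0 (b : ℚ)).symm
  have hsub : {τ : ℂ | ∃ lam : ℍ[ℚ,(a : ℚ),(b : ℚ)], lam ∉ (⊥ : Subalgebra ℚ ℍ[ℚ,(a : ℚ),(b : ℚ)]) ∧
      ∃ g : ℂ, act (rho a b hb.le (castQ a b lam)) (uVec τ) = g • uVec τ} ⊆
      ⋃ lam : ℍ[ℚ,(a : ℚ),(b : ℚ)], {τ : ℂ | lam ∉ (⊥ : Subalgebra ℚ ℍ[ℚ,(a : ℚ),(b : ℚ)]) ∧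
        ∃ g : ℂ, act (rho a b hb.le (castQ a b lam)) (uVec τ) = g • uVec τ} := by
    rintro τ ⟨lam, hlam, g, h⟩
    exact Set.mem_iUnion.mpr ⟨lam, hlam, g, h⟩
  refine (Set.countable_iUnion fun lam ↦ ?_).mono hsub
  by_cases hlam : lam ∈ (⊥ : Subalgebra ℚ ℍ[ℚ,(a : ℚ),(b : ℚ)])
  · have : {τ : ℂ | lam ∉ (⊥ : Subalgebra ℚ ℍ[ℚ,(a : ℚ),(b : ℚ)]) ∧
        ∃ g : ℂ, act (rho a b hb.le (castQ a b lam)) (uVec τ) = g • uVec τ} = ∅ :=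
      Set.eq_empty_iff_forall_notMem.mpr fun τ hmem ↦ hmem.1 hlam
    rw [this]
    exact Set.countable_empty
  · exact ((finite_setOf_eigen ha hb hlam).subset fun τ hmem ↦ hmem.2).countable

include ha in
/-- **The CM locus `{τ : L_τ ≠ ℚ}` of the family is countable** (for every `a ≠ 0 < b`, division or split `Q`).
[cite: KudlaRapoportYang2006, §1 p. 9 and §3.4] [cite: HulekLaface2019PicardNumbersAV, §5.1 Prop. 5.1 (proof)] -/
theorem countable_setOf_fixed_ne_bot :
    Set.Countable {τ : ℂ | ∃ S : Subalgebra ℚ ℍ[ℚ,(a : ℚ),(b : ℚ)],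
      (∀ lam, lam ∈ S ↔ ∃ g : ℂ, act (rho a b hb.le (castQ a b lam)) (uVec τ) = g • uVec τ) ∧ S ≠ ⊥} := by
  refine (countable_setOf_exists_eigen ha hb).mono ?_
  rintro τ ⟨S, hS, hne⟩
  obtain ⟨lam, hlamS, hlam⟩ : ∃ lam ∈ S, lam ∉ (⊥ : Subalgebra ℚ ℍ[ℚ,(a : ℚ),(b : ℚ)]) := by
    by_contra! h
    exact hne (eq_bot_iff.2 fun lam hlam ↦ h lam hlam)
  exact ⟨lam, hlam, (hS lam).1 hlamS⟩

end Countable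

/-! ## §2 `ρ(A(τ)) = 2 + [L_τ : ℚ]` on the whole family (`a < 0 < b`, any `Q`) -/

section PicardNumber

variable {a b : ℤ} (ha : a < 0) (hb : 0 < b) {τ : ℂ} (hτ : τ.im ≠ 0)
  {S : Subalgebra ℚ ℍ[ℚ,(a : ℚ),(b : ℚ)]}
  (hS : ∀ lam, lam ∈ S ↔ ∃ g : ℂ, act (rho a b hb.le (castQ a b lam)) (uVec τ) = g • uVec τ)

include ha hb hτ in
/-- **A simple member forces `Q` to be a division algebra** (g14-#7: a split `Q` makes every member non-simple).
[cite: Lange2023AbelianVarietiesComplex, §5.1.5 Exercise (2)(b)] -/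
theorem forall_isUnit_of_isSimple (hX : IsSimple (period a b ha.ne hb hτ)) :
    ∀ x : ℍ[ℚ,(a : ℚ),(b : ℚ)], x ≠ 0 → IsUnit x := by
  by_contra h
  exact not_isSimple_of_split ha.ne hb hτ h hX

include ha hτ hS in
/-- **`[L_τ : ℚ] ≤ 2`** for `a < 0 < b` with NO hypothesis on `Q` (division: g14-#5; split: g14-#7).
[cite: Lange2023AbelianVarietiesComplex, §5.1.5 Exercise (1)–(2)] -/
theorem finrank_fixed_le_two' : finrank ℚ S ≤ 2 := by
  by_cases hQ : ∀ x : ℍ[ℚ,(a : ℚ),(b : ℚ)], x ≠ 0 → IsUnit x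
  · exact finrank_fixed_le_two ha.ne hb hτ hS hQ
  · exact finrank_fixed_le_two_of_split ha hb hτ hS hQ

/-- `1 ≤ dim T` for a subalgebra `T ⊆ Q`. [folklore] -/
private theorem one_le_finrank_subalgebra (T : Subalgebra ℚ ℍ[ℚ,(a : ℚ),(b : ℚ)]) : 1 ≤ finrank ℚ T := by
  have h1 : finrank ℚ (⊥ : Subalgebra ℚ ℍ[ℚ,(a : ℚ),(b : ℚ)]) ≤ finrank ℚ T := by
    rw [← Subalgebra.finrank_toSubmodule, ← Subalgebra.finrank_toSubmodule]
    exact Submodule.finrank_mono (Subalgebra.toSubmodule.monotone bot_le)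
  rwa [Subalgebra.finrank_bot] at h1

include hS in
/-- **`ρ(A(τ)) = 2 + [L_τ : ℚ]` for every member of the family** (`a < 0 < b`, any `Q`): for a simple member `Q` is a
division algebra, `ρ = 3` (g13-#4) and `L_τ = ℚ` (g14-#5); for a non-simple member `A(τ) ∼ Y²` (g14-#7),
`ρ(Y × Y) = 2 + [End_ℚ(Y) : ℚ]` and `End_ℚ(Y) ≅ L_τ` (g14-#6). [cite: HulekLaface2019PicardNumbersAV, §1 («Picard number three, unless they also have complex multiplication … Picard number four»)] [cite: Lange2023AbelianVarietiesComplex, §5.1.5 Exercise (2) and §2.6.3 Exercise (2)] -/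
theorem finrank_neronSeveriGroup_eq_two_add_finrank_fixed :
    finrank ℤ (neronSeveriGroup (period a b ha.ne hb hτ)) = 2 + finrank ℚ S := by
  by_cases hX : IsSimple (period a b ha.ne hb hτ)
  · have hQ := forall_isUnit_of_isSimple ha hb hτ hX
    rw [hX.finrank_neronSeveriGroup_eq_three_of_quaternionAlgebra (lmul a b) (lmul_mem_endAlgRat ha.ne hb hτ)
      (Module.finrank_fin_fun ℂ) ha.ne hb hQ, (fixed_eq_bot_iff_isSimple ha.ne hb hτ hS hQ).2 hX,
      Subalgebra.finrank_bot]
  · obtain ⟨V, hV, hVc, hrV, hiso, -⟩ := exists_isIsogenous_sq_of_not_isSimple ha hb hτ hX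
    obtain ⟨η, -, -, hη, -, -⟩ := exists_admissible ha hb hτ
    have hYc : Fintype.card (Fin (subRank V)) = 2 := by rw [Fintype.card_fin, hrV]
    have hYa : IsAbelianVariety (subtorusPeriod (period a b ha.ne hb hτ) V hV hVc) :=
      ⟨_, isRiemannForm_restrict (period a b ha.ne hb hτ) hη hV hVc⟩
    have hprod : IsIsogenous (period a b ha.ne hb hτ)
        (prodPeriod (subtorusPeriod (period a b ha.ne hb hτ) V hV hVc)
          (subtorusPeriod (period a b ha.ne hb hτ) V hV hVc)) :=
      IsIsogenous.trans _ _ _ hiso (IsIsogenous.symm _ _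
        ((IsIsogenous.refl _).prod_powPeriod_two (IsIsogenous.refl _)))
    obtain ⟨f⟩ := nonempty_algEquiv_endAlgRat_fixed_of_isIsogenous ha.ne hb hτ hS hYc hiso
    rw [hprod.finrank_neronSeveriGroup_eq_two_add_of_isIsogenous hYc hYc hYa (IsIsogenous.refl _),
      f.toLinearEquiv.finrank_eq]

include hS in
/-- **`ρ(A(τ)) ∈ {3, 4}`** for every member (`a < 0 < b`, any `Q`). [cite: HulekLaface2019PicardNumbersAV, §1] -/
theorem finrank_neronSeveriGroup_eq_three_or_eq_four :
    finrank ℤ (neronSeveriGroup (period a b ha.ne hb hτ)) = 3 ∨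
      finrank ℤ (neronSeveriGroup (period a b ha.ne hb hτ)) = 4 := by
  have h := finrank_neronSeveriGroup_eq_two_add_finrank_fixed ha hb hτ hS
  have h1 := one_le_finrank_subalgebra S
  have h2 := finrank_fixed_le_two' ha hb hτ hS
  omega

include hS in
/-- **`ρ(A(τ)) = 4` iff `τ` is a CM point (`[L_τ : ℚ] = 2`).** [cite: HulekLaface2019PicardNumbersAV, §1 («unless they also have complex multiplication … Picard number four»)] [cite: KudlaRapoportYang2006, §3.4] -/
theorem finrank_neronSeveriGroup_eq_four_iff :
    finrank ℤ (neronSeveriGroup (period a b ha.ne hb hτ)) = 4 ↔ finrank ℚ S = 2 := by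
  have h := finrank_neronSeveriGroup_eq_two_add_finrank_fixed ha hb hτ hS
  omega

include hS in
/-- **`ρ(A(τ)) = 3` iff `L_τ = ℚ`.** [cite: HulekLaface2019PicardNumbersAV, §1 («abelian surfaces with quaternionic multiplication have Picard number three»)] -/
theorem finrank_neronSeveriGroup_eq_three_iff :
    finrank ℤ (neronSeveriGroup (period a b ha.ne hb hτ)) = 3 ↔ S = ⊥ := by
  rw [← Subalgebra.finrank_eq_one_iff (S := S)]
  have h := finrank_neronSeveriGroup_eq_two_add_finrank_fixed ha hb hτ hS
  omega

include ha in
/-- **«Picard number three, unless they also have complex multiplication»: `ρ(A(τ)) = 4` only on a countable set of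
`τ`** (every `a < 0 < b`, division or split `Q`; the split family has `ρ = 3` at a general `τ` although no member is
simple). [cite: HulekLaface2019PicardNumbersAV, §1 and §5.1 Prop. 5.1] [cite: KudlaRapoportYang2006, §1 p. 9] -/
theorem countable_setOf_finrank_neronSeveriGroup_eq_four :
    Set.Countable {τ : ℂ | ∃ hτ : τ.im ≠ 0, finrank ℤ (neronSeveriGroup (period a b ha.ne hb hτ)) = 4} := by
  refine (countable_setOf_fixed_ne_bot ha.ne hb).mono ?_
  rintro τ ⟨hτ, h4⟩
  obtain ⟨S, hS⟩ := exists_fixedSubalgebra (a := a) hb (τ := τ)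
  refine ⟨S, hS, fun hbot ↦ ?_⟩
  have h2 := (finrank_neronSeveriGroup_eq_four_iff ha hb hτ hS).1 h4
  rw [hbot, Subalgebra.finrank_bot] at h2
  omega

end PicardNumber

end QuaternionType

end ComplexTorus

end Literature.Geometry.Kaehler
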